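import Literature.InformationTheory.QuantumCodes.DrawnCheckMatrixSpaceTime
import Literature.InformationTheory.QuantumCodes.RotatedSurfaceCodeCrossingPathsZ
import HarnessLib

/-!
# The rotated surface code as a check matrix drawn on `ℤ²`, `H_Z` sector (ALL faces), and its space-time counting bound
# under noisy syndrome measurement: `Prob[odd row-0 projected residual] ≤ L·T·C·r^L/(1-r)` with `cₙ(ℤ³) ≤ C νⁿ`

Topic `Literature/InformationTheory/QuantumCodes` (venture QEC, LADDER-QEC rung Q5, PARTITION row 09 "phenomenological";
qec-type-09 gen 7, cell item «09.RSCPH»). All PROVED, kernel axioms, no named fact. Twin of `RotatedSurfaceCodeDrawing.lean` for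
the `Z`-checks, on top of gen 6's second lift `RotatedSurfaceCodeLiftZ.lean` (valid `Z`-faces `(a, b')`, `a + b'` even, at
`zsite (a, b') = ((a+b')/2, (b'-a)/2)`, `u - v = a`; qubit `(i, j)` as the unit bond `zbond (i, j)` whose ends have
`u - v ∈ {i-1, i}`; rough edges = the qubit ROWS `i = 0` (`vbotZ j`, `u - v = -1`) and `i = L-1` (`vtopZ j`, `u - v = L-1`)).
The faces of the wrong colour (zero rows of `H_Z`) are parked at `fsiteZ (a, b') = (a, a+b'+2)`, off the strip, so that
INCIDENCE = GEOMETRY holds for every row of `HZ L` and the generic space-time lift applies.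

* `endLoZ`, `endHiZ`, `zbond_eq`, `endLoZ_sub`, `endHiZ_sub`, `exists_zsite_eq_endLoZ/HiZ`, `endLoZ_eq_vbotZ`,
  `endHiZ_eq_vtopZ` — the two ends of the `Z`-bond of the qubit `(i, j)` (`u - v = i-1` resp. `i`) and what they are;
* `fsiteZ`, `fsiteZ_injective`, ★ `rscDrawingZ L : CheckDrawing (HZ L) 2 (Fin L) (Fin L)` with `bot (i, j) = [i = 0]`;
  `rscDrawingZ_heightGap : HeightGap L`, `sum_mul_rscDrawingZ_bot` (`Σ_q c(q)·bot(q) = Σ_j c(0, j)`);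
* ★ `rsc_stZ_sum_oddResidual_le_twoRate` / `rsc_stZ_sum_oddResidual_le` — for `L ≥ 1`, `T` noisy rounds with rates
  `p, q ≤ ρ ≤ 1/2` (resp. `q = p`), a minimum-weight SPACE-TIME decoder of the `H_Z` sector and `cₙ(ℤ³) ≤ C νⁿ`,
  `r = 2ν√(ρ(1-ρ)) < 1`: the total probability of the histories whose residual projects to a chain with an odd number of
  row-`0` qubits is `≤ L·T·C·r^L/(1-r)`; `rsc_stZ_tendsto_sum_oddResidual(_twoRate)` — `→ 0` along `L = i + 1` for
  polynomially many rounds when `4ν² ρ(1-ρ) < 1`.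

## References

* [DennisEtAl2002] E. Dennis, A. Kitaev, A. Landahl, J. Preskill, *Topological quantum memory*, J. Math. Phys. 43 (2002)
  4452–4505, arXiv:quant-ph/0110143, §3.2 (rough edges), §4.2–4.3 (space-time lattice, syndrome = boundary), §5.2–5.3
  (eqs. (e_ineq), (saw_L), (saw_3), (threshold_iso), (fail_iso); relative polygons of planar codes).
* [TomitaSvore2014] Y. Tomita, K. M. Svore, PRA 90 (2014) 062320, §2.2 (the rotated layout, Surface-17).
-/

namespace Literature.InformationTheory.QuantumCodes

namespace RotatedSurface

open Finset Matrix Filter Topology CSSPhenom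
open Literature.Probability.LatticeModels (Site zdGraph)
open Literature.Probability.RandomPlanarGeometry

variable {L : ℕ}

/-- Sites are determined by their coordinates. [folklore] -/
private theorem spt_eq_spt_iffZ {u v u' v' : ℤ} : spt u v = spt u' v' ↔ u = u' ∧ v = v' := by
  refine ⟨fun h => ?_, by rintro ⟨rfl, rfl⟩; rfl⟩
  exact ⟨by simpa [spt] using congrFun h 0, by simpa [spt] using congrFun h 1⟩

/-- Coordinates of `spt`. [folklore] -/
private theorem spt_subZ (u v : ℤ) : spt u v 0 - spt u v 1 = u - v := by simp [spt]

/-! ### The two ends of the `Z`-bond of a qubit -/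

/-- **The lower end** of the `Z`-bond of the qubit `(i, j)` (the end with `u - v = i - 1`): `((i+j)/2, (j-i)/2 + 1)` if `i + j`
is even, `((i+j-1)/2, (j-i+1)/2)` if odd. [cite: TomitaSvore2014, §2.2 (the two Z stabilizers of a data qubit)] -/
def endLoZ (q : Fin L × Fin L) : Site 2 :=
  if (q.1.val + q.2.val) % 2 = 0 then spt (((q.1.val : ℤ) + q.2.val) / 2) (((q.2.val : ℤ) - q.1.val) / 2 + 1)
  else spt (((q.1.val : ℤ) + q.2.val - 1) / 2) (((q.2.val : ℤ) - q.1.val + 1) / 2)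

/-- **The upper end** of the `Z`-bond of the qubit `(i, j)` (the end with `u - v = i`): `((i+j)/2, (j-i)/2)` if `i + j` is
even, `((i+j-1)/2 + 1, (j-i+1)/2)` if odd. [cite: TomitaSvore2014, §2.2 (the two Z stabilizers of a data qubit)] -/
def endHiZ (q : Fin L × Fin L) : Site 2 :=
  if (q.1.val + q.2.val) % 2 = 0 then spt (((q.1.val : ℤ) + q.2.val) / 2) (((q.2.val : ℤ) - q.1.val) / 2)
  else spt (((q.1.val : ℤ) + q.2.val - 1) / 2 + 1) (((q.2.val : ℤ) - q.1.val + 1) / 2)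

/-- `zbond q = {endLoZ q, endHiZ q}`. [cite: TomitaSvore2014, §2.2] -/
theorem zbond_eq (q : Fin L × Fin L) : zbond q = s(endLoZ q, endHiZ q) := by
  unfold zbond endLoZ endHiZ
  split_ifs with h
  · exact Sym2.eq_swap
  · rfl

/-- The lower end lies on the diagonal `u - v = i - 1`. [cite: DennisEtAl2002, §3.2] -/
theorem endLoZ_sub (q : Fin L × Fin L) : endLoZ q 0 - endLoZ q 1 = (q.1.val : ℤ) - 1 := by
  unfold endLoZ
  split_ifs with h <;> rw [spt_subZ] <;> omega

/-- The upper end lies on the diagonal `u - v = i`. [cite: DennisEtAl2002, §3.2] -/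
theorem endHiZ_sub (q : Fin L × Fin L) : endHiZ q 0 - endHiZ q 1 = (q.1.val : ℤ) := by
  unfold endHiZ
  split_ifs with h <;> rw [spt_subZ] <;> omega

/-- **For `i ≥ 1` the lower end is the site of a valid `Z`-face** (`(i-1, j+1)` if `i + j` is even, `(i-1, j)` if odd).
[cite: TomitaSvore2014, §2.2 (Z stabilizers of the rotated layout)] -/
theorem exists_zsite_eq_endLoZ (q : Fin L × Fin L) (hi : 1 ≤ q.1.val) :
    ∃ z : Fin (L - 1) × Fin (L + 1), (z.1.val + z.2.val) % 2 = 0 ∧ zsite z = endLoZ q := by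
  obtain ⟨i, j⟩ := q
  unfold zsite endLoZ
  simp only at hi ⊢
  by_cases h : (i.val + j.val) % 2 = 0
  · refine ⟨(⟨i.val - 1, by omega⟩, ⟨j.val + 1, by omega⟩), ?_, ?_⟩
    · simp only; omega
    · rw [if_pos h, spt_eq_spt_iffZ]; simp only; omega
  · refine ⟨(⟨i.val - 1, by omega⟩, ⟨j.val, by omega⟩), ?_, ?_⟩
    · simp only; omega
    · rw [if_neg h, spt_eq_spt_iffZ]; simp only; omega

/-- **For `i ≤ L - 2` the upper end is the site of a valid `Z`-face** (`(i, j)` if `i + j` is even, `(i, j+1)` if odd).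
[cite: TomitaSvore2014, §2.2 (Z stabilizers of the rotated layout)] -/
theorem exists_zsite_eq_endHiZ (q : Fin L × Fin L) (hi : q.1.val + 2 ≤ L) :
    ∃ z : Fin (L - 1) × Fin (L + 1), (z.1.val + z.2.val) % 2 = 0 ∧ zsite z = endHiZ q := by
  obtain ⟨i, j⟩ := q
  unfold zsite endHiZ
  simp only at hi ⊢
  by_cases h : (i.val + j.val) % 2 = 0
  · refine ⟨(⟨i.val, by omega⟩, ⟨j.val, by omega⟩), ?_, ?_⟩
    · simp only; omega
    · rw [if_pos h]
  · refine ⟨(⟨i.val, by omega⟩, ⟨j.val + 1, by omega⟩), ?_, ?_⟩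
    · simp only; omega
    · rw [if_neg h, spt_eq_spt_iffZ]; simp only; omega

/-- **In row `0` the lower end is the virtual site `vbotZ j`.** [cite: DennisEtAl2002, §3.2 (rough edge: links with one end off the lattice)] -/
theorem endLoZ_eq_vbotZ (q : Fin L × Fin L) (hi : q.1.val = 0) : endLoZ q = vbotZ q.2 := by
  obtain ⟨i, j⟩ := q
  unfold endLoZ vbotZ
  simp only at hi ⊢
  by_cases h : (i.val + j.val) % 2 = 0
  · rw [if_pos h, if_pos (by omega), spt_eq_spt_iffZ]; omega
  · rw [if_neg h, if_neg (by omega), spt_eq_spt_iffZ]; omega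

/-- **In row `L - 1` the upper end is the virtual site `vtopZ j`.** [cite: DennisEtAl2002, §3.2 (the opposite rough edge)] -/
theorem endHiZ_eq_vtopZ (q : Fin L × Fin L) (hi : q.1.val = L - 1) : endHiZ q = vtopZ q.2 := by
  obtain ⟨i, j⟩ := q
  have hL : 1 ≤ L := by have := i.2; omega
  unfold endHiZ vtopZ
  simp only at hi ⊢
  by_cases h : (i.val + j.val) % 2 = 0
  · rw [if_pos h, if_pos (by omega), spt_eq_spt_iffZ]; omega
  · rw [if_neg h, if_neg (by omega), spt_eq_spt_iffZ]; omega

/-! ### Sites for ALL `Z`-faces -/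

/-- **The site of a `Z`-face**: `zsite` for the valid faces (`a + b'` even); the faces of the wrong colour (zero rows of `H_Z`)
are parked at `(a, a+b'+2)`, on the diagonals `u - v ≤ -2` off the strip. [cite: TomitaSvore2014, §2.2 (the Z stabilizers of the rotated layout)] -/
def fsiteZ (z : Fin (L - 1) × Fin (L + 1)) : Site 2 :=
  if (z.1.val + z.2.val) % 2 = 0 then zsite z else spt z.1.val ((z.1.val : ℤ) + z.2.val + 2)

/-- `fsiteZ = zsite` on valid faces. [cite: TomitaSvore2014, §2.2] -/
theorem fsiteZ_of_valid {z : Fin (L - 1) × Fin (L + 1)} (hz : (z.1.val + z.2.val) % 2 = 0) : fsiteZ z = zsite z := by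
  unfold fsiteZ; rw [if_pos hz]

/-- Parked faces lie on `u - v = -(b'+2) ≤ -2`. [cite: TomitaSvore2014, §2.2] -/
theorem fsiteZ_sub_of_invalid {z : Fin (L - 1) × Fin (L + 1)} (hz : ¬ (z.1.val + z.2.val) % 2 = 0) :
    fsiteZ z 0 - fsiteZ z 1 = -((z.2.val : ℤ) + 2) := by
  unfold fsiteZ; rw [if_neg hz, spt_subZ]; ring

/-- Every `Z`-face site lies off the two rough diagonals: `u - v ∉ {-1, L-1}`. [cite: DennisEtAl2002, §3.2 (the checks lie between the two rough edges)] -/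
theorem fsiteZ_sub_ne (z : Fin (L - 1) × Fin (L + 1)) :
    fsiteZ z 0 - fsiteZ z 1 ≠ -1 ∧ fsiteZ z 0 - fsiteZ z 1 ≠ (L : ℤ) - 1 := by
  have ha := z.1.2
  by_cases hz : (z.1.val + z.2.val) % 2 = 0
  · rw [fsiteZ_of_valid hz, zsite_sub_eq hz]; omega
  · rw [fsiteZ_sub_of_invalid hz]; omega

/-- **`fsiteZ` is injective.** [cite: TomitaSvore2014, §2.2 (distinct stabilizers)] -/
theorem fsiteZ_injective : Function.Injective (fsiteZ (L := L)) := by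
  intro z z' h
  by_cases hz : (z.1.val + z.2.val) % 2 = 0 <;> by_cases hz' : (z'.1.val + z'.2.val) % 2 = 0
  · rw [fsiteZ_of_valid hz, fsiteZ_of_valid hz'] at h
    exact zsite_injOn hz hz' h
  · exfalso
    have h1 := zsite_sub_eq hz
    have h2 := fsiteZ_sub_of_invalid hz'
    rw [← fsiteZ_of_valid hz, h] at h1
    omega
  · exfalso
    have h1 := fsiteZ_sub_of_invalid hz
    have h2 := zsite_sub_eq hz'
    rw [h, fsiteZ_of_valid hz'] at h1
    omega
  · unfold fsiteZ at h
    rw [if_neg hz, if_neg hz', spt_eq_spt_iffZ] at h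
    obtain ⟨a, b⟩ := z
    obtain ⟨a', b'⟩ := z'
    simp only [Prod.mk.injEq, Fin.ext_iff] at h ⊢
    omega

/-! ### The drawing -/

open Classical in
/-- ★ **The `H_Z` sector of `RSC(L)` as a check matrix drawn on `ℤ²`** (all faces, zero rows parked off the strip): sites
`fsiteZ`, bonds `zbond`, bottom / top virtual sites `vbotZ` / `vtopZ` (the rough edges of this sector are the qubit rows
`0` and `L-1`), and `bot (i, j) = [i = 0]`. [cite: DennisEtAl2002, §3.2 (planar codes: rough edges)] [cite: TomitaSvore2014, §2.2 (the rotated layout)] -/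
def rscDrawingZ (L : ℕ) : CheckDrawing (HZ L) 2 (Fin L) (Fin L) where
  site := fsiteZ
  bond := zbond
  vb := vbotZ
  vt := vtopZ
  bot q := if q.1.val = 0 then 1 else 0
  site_injective := fsiteZ_injective
  bond_injective := zbond_injective
  adj_of_bond_eq q P P' h := zdGraph_adj_of_zbond_eq q h
  apply_eq_ite z q := by
    by_cases hz : (z.1.val + z.2.val) % 2 = 0
    · rw [HZ_apply_eq_ite_of_valid hz, fsiteZ_of_valid hz]
    · rw [HZ_eq_zero_of_invalid z hz, Pi.zero_apply, if_neg]
      intro hm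
      rw [zbond_eq, Sym2.mem_iff] at hm
      have h0 := fsiteZ_sub_of_invalid hz
      rcases hm with hm | hm
      · have := endLoZ_sub q; rw [← hm] at this; omega
      · have := endHiZ_sub q; rw [← hm] at this; omega
  site_ne_vb z j h := by
    have h1 := (fsiteZ_sub_ne z).1
    rw [h, vbotZ_sub] at h1
    exact h1 rfl
  site_ne_vt z j h := by
    have hL : 1 ≤ L := by have := j.2; omega
    have h1 := (fsiteZ_sub_ne z).2
    rw [h, vtopZ_sub hL] at h1
    exact h1 rfl
  vb_ne_vt j j' h := by
    have hL : 1 ≤ L := by have := j.2; omega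
    have h1 := vbotZ_sub j
    rw [h, vtopZ_sub hL] at h1
    omega
  ends_cases q P hP := by
    rw [zbond_eq, Sym2.mem_iff] at hP
    have hi := q.1.2
    rcases hP with rfl | rfl
    · by_cases hi0 : q.1.val = 0
      · exact Or.inr (Or.inl ⟨q.2, (endLoZ_eq_vbotZ q hi0).symm⟩)
      · obtain ⟨z, hz, hze⟩ := exists_zsite_eq_endLoZ q (by omega)
        exact Or.inl ⟨z, by rw [← hze]; exact fsiteZ_of_valid hz⟩
    · by_cases hiL : q.1.val = L - 1
      · exact Or.inr (Or.inr ⟨q.2, (endHiZ_eq_vtopZ q hiL).symm⟩)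
      · obtain ⟨z, hz, hze⟩ := exists_zsite_eq_endHiZ q (by omega)
        exact Or.inl ⟨z, by rw [← hze]; exact fsiteZ_of_valid hz⟩
  bot_eq q P P' h := by
    have hHi : ¬ ∃ j : Fin L, vbotZ j = endHiZ q := by
      rintro ⟨j, hj⟩
      have h1 := vbotZ_sub j
      rw [hj, endHiZ_sub] at h1
      omega
    rw [zbond_eq, Sym2.eq_iff] at h
    by_cases hi0 : q.1.val = 0
    · have hLo : ∃ j : Fin L, vbotZ j = endLoZ q := ⟨q.2, (endLoZ_eq_vbotZ q hi0).symm⟩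
      rcases h with ⟨rfl, rfl⟩ | ⟨rfl, rfl⟩
      · simp only [hi0, hLo, hHi, if_true, if_false, add_zero]
      · simp only [hi0, hLo, hHi, if_true, if_false, zero_add]
    · have hLo : ¬ ∃ j : Fin L, vbotZ j = endLoZ q := by
        rintro ⟨j, hj⟩
        have h1 := vbotZ_sub j
        rw [hj, endLoZ_sub] at h1
        omega
      rcases h with ⟨rfl, rfl⟩ | ⟨rfl, rfl⟩
      · simp only [hi0, hLo, hHi, if_false, add_zero]
      · simp only [hi0, hLo, hHi, if_false, add_zero]

/-- **Height gap `L`** for the `Z`-drawing: the height `u - v` is `-1` on `vbotZ` and `L - 1` on `vtopZ` (`L ≥ 1`).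
[cite: DennisEtAl2002, §5.2 ("homologically nontrivial (self-avoiding) path must contain at least L links")] -/
theorem rscDrawingZ_heightGap (hL : 1 ≤ L) : (rscDrawingZ L).HeightGap L := by
  refine ⟨Pi.evalAddMonoidHom (fun _ : Fin 2 => ℤ) 0 - Pi.evalAddMonoidHom (fun _ : Fin 2 => ℤ) 1, -1, fun i => ?_,
    fun b => ?_, fun t => ?_⟩
  · fin_cases i <;> simp
  · show vbotZ b 0 - vbotZ b 1 = -1
    exact vbotZ_sub b
  · show vtopZ t 0 - vtopZ t 1 = -1 + (L : ℤ)
    rw [vtopZ_sub hL]; ring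

/-- **The bottom crossing number is the row-`0` parity**: `Σ_q c(q)·bot(q) = Σ_j c(0, j)`.
[cite: DennisEtAl2002, §3.2 (a relative cycle crosses the rough edge)] -/
theorem sum_mul_rscDrawingZ_bot (hL : 0 < L) (c : Fin L × Fin L → ZMod 2) :
    ∑ q, c q * (rscDrawingZ L).bot q = ∑ j : Fin L, c (⟨0, hL⟩, j) := by
  simp only [rscDrawingZ, Fintype.sum_prod_type, mul_ite, mul_one, mul_zero]
  rw [Finset.sum_eq_single (⟨0, hL⟩ : Fin L)]
  · simp
  · intro i _ hi
    exact Finset.sum_eq_zero fun j _ => if_neg fun h => hi (Fin.ext h)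
  · intro h; exact absurd (Finset.mem_univ _) h

/-! ### The space-time counting bound for the `H_Z` sector of `RSC(L)` -/

open Classical in
/-- ★ **DKLP's counting bound for the rotated surface code with NOISY syndrome measurement** (`H_Z` sector, `L ≥ 1`, `T` rounds,
TWO RATES: qubit faults at rate `p`, measurement faults at rate `q`, `0 ≤ p, q ≤ ρ ≤ 1/2`): for a minimum-weight space-time
decoder `D` and a walk count `cₙ(ℤ³) ≤ C νⁿ` with `r = 2ν√(ρ(1-ρ)) < 1`, the total probability of the histories whose residual
projects to a chain with an odd number of row-`0` qubits is at most `L·T·C·r^L/(1-r)` (`L·T` bottom rough space-time sites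
to start a relative polygon from). [cite: DennisEtAl2002, §5.2 eqs. (saw_prob), (saw_L), §5.3 eqs. (saw_3), (fail_iso), (threshold_iso_num)] -/
theorem rsc_stZ_sum_oddResidual_le_twoRate (hL : 0 < L) {C ν : ℝ} (hν : 0 < ν) (hC : ToricCode.SAWCountBound3 C ν) {T : ℕ}
    {D : STDecoder (Fin (L - 1) × Fin (L + 1)) (Fin L × Fin L) T}
    (hD : D.IsMinWeight (stSyn (HZ L) T) (stCycles (HZ L) T) hammingNorm)
    {p q ρ : ℝ} (hp0 : 0 ≤ p) (hq0 : 0 ≤ q) (hpρ : p ≤ ρ) (hqρ : q ≤ ρ) (hρ : ρ ≤ 1 / 2)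
    (hr1 : 2 * ν * Real.sqrt (ρ * (1 - ρ)) < 1) :
    ∑ E ∈ univ.filter (fun E : History (Fin (L - 1) × Fin (L + 1)) (Fin L × Fin L) T =>
        ∑ i : Fin L, proj (D (stSyn (HZ L) T E) + E) (⟨0, hL⟩, i) = 1), phenomenologicalWeight T p q (supp E) ≤
      (L : ℝ) * T * C * (2 * ν * Real.sqrt (ρ * (1 - ρ))) ^ L / (1 - 2 * ν * Real.sqrt (ρ * (1 - ρ))) := by
  classical
  have h := (rscDrawingZ L).spaceTime_sum_oddResidual_le_twoRate T (rscDrawingZ_heightGap hL) hν hC hD hp0 hq0 hpρ hqρ hρ hr1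
  rw [Fintype.card_fin] at h
  refine le_trans (le_of_eq (Finset.sum_congr (Finset.filter_congr fun E _ => ?_) fun _ _ => rfl)) h
  rw [sum_mul_rscDrawingZ_bot hL]

open Classical in
/-- **The same with equal rates `q = p`** (`0 ≤ p ≤ 1/2`, `r = 2ν√(p(1-p)) < 1`): `≤ L·T·C·r^L/(1-r)`.
[cite: DennisEtAl2002, §5.3 eqs. (saw_3), (fail_iso)] -/
theorem rsc_stZ_sum_oddResidual_le (hL : 0 < L) {C ν : ℝ} (hν : 0 < ν) (hC : ToricCode.SAWCountBound3 C ν) {T : ℕ}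
    {D : STDecoder (Fin (L - 1) × Fin (L + 1)) (Fin L × Fin L) T}
    (hD : D.IsMinWeight (stSyn (HZ L) T) (stCycles (HZ L) T) hammingNorm)
    {p : ℝ} (hp0 : 0 ≤ p) (hp : p ≤ 1 / 2) (hr1 : 2 * ν * Real.sqrt (p * (1 - p)) < 1) :
    ∑ E ∈ univ.filter (fun E : History (Fin (L - 1) × Fin (L + 1)) (Fin L × Fin L) T =>
        ∑ i : Fin L, proj (D (stSyn (HZ L) T E) + E) (⟨0, hL⟩, i) = 1), phenomenologicalWeight T p p (supp E) ≤
      (L : ℝ) * T * C * (2 * ν * Real.sqrt (p * (1 - p))) ^ L / (1 - 2 * ν * Real.sqrt (p * (1 - p))) :=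
  rsc_stZ_sum_oddResidual_le_twoRate hL hν hC hD hp0 hp0 le_rfl le_rfl hp hr1

open Classical in
/-- **The rotated space-time counting bound tends to zero inside the box `p, q ≤ ρ < p₀(ν)`** along `L = i + 1`: under
`cₙ(ℤ³) ≤ C νⁿ`, for every polynomially bounded schedule of rounds `T(i)`, every family of minimum-weight space-time decoders of
the `H_Z` sectors and all rates `0 ≤ p, q ≤ ρ ≤ 1/2` with `4ν² ρ(1-ρ) < 1`: `(i+1)·T(i)·C·r^{i+1}/(1-r) → 0`.
[cite: DennisEtAl2002, §5.3 eqs. (threshold_iso), (fail_iso), (threshold_iso_num) ("with T increasing no faster than a polynomial of L")] -/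
theorem rsc_stZ_tendsto_sum_oddResidual_twoRate {C ν : ℝ} (hν : 0 < ν) (hC : ToricCode.SAWCountBound3 C ν) {Tk : ℕ → ℕ}
    (hT : ToricCode.IsPolyBounded Tk)
    (D : ∀ i : ℕ, STDecoder (Fin (i + 1 - 1) × Fin (i + 1 + 1)) (Fin (i + 1) × Fin (i + 1)) (Tk i))
    (hD : ∀ i, (D i).IsMinWeight (stSyn (HZ (i + 1)) (Tk i)) (stCycles (HZ (i + 1)) (Tk i)) hammingNorm)
    {p q ρ : ℝ} (hp0 : 0 ≤ p) (hq0 : 0 ≤ q) (hpρ : p ≤ ρ) (hqρ : q ≤ ρ) (hρ : ρ ≤ 1 / 2)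
    (h4 : 4 * ν ^ 2 * (ρ * (1 - ρ)) < 1) :
    Tendsto (fun i => ∑ E ∈ univ.filter (fun E : History (Fin (i + 1 - 1) × Fin (i + 1 + 1)) (Fin (i + 1) × Fin (i + 1))
        (Tk i) => ∑ j : Fin (i + 1), proj (D i (stSyn (HZ (i + 1)) (Tk i) E) + E) (⟨0, by omega⟩, j) = 1),
        phenomenologicalWeight (Tk i) p q (supp E)) atTop (𝓝 0) := by
  set s := Real.sqrt (ρ * (1 - ρ)) with hs
  set r := 2 * ν * s with hr
  have hs0 : 0 ≤ s := Real.sqrt_nonneg _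
  have hr0 : 0 ≤ r := by rw [hr]; positivity
  have hρ0 : 0 ≤ ρ := hp0.trans hpρ
  have hpp : 0 ≤ ρ * (1 - ρ) := mul_nonneg hρ0 (by linarith)
  have hr1 : r < 1 := by
    have hsq : r ^ 2 = 4 * ν ^ 2 * (ρ * (1 - ρ)) := by
      rw [hr, mul_pow, mul_pow, hs, Real.sq_sqrt hpp]
      ring
    have h : r ^ 2 < 1 := by rw [hsq]; exact h4
    have := (sq_lt_one_iff_abs_lt_one r).1 h
    rwa [abs_of_nonneg hr0] at this
  have h1r : 0 < 1 - r := by linarith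
  have hC0 : 0 ≤ C := by
    have h0 := hC 0
    rw [SAW.Zd.count_zero, pow_zero, mul_one, Nat.cast_one] at h0
    linarith
  obtain ⟨A, m, hA⟩ := hT
  have hA0 : 0 ≤ A := by
    have := hA 0
    have h0 : (0 : ℝ) ≤ (Tk 0 : ℝ) := Nat.cast_nonneg _
    simp only [Nat.cast_zero, zero_add, one_pow, mul_one] at this
    linarith
  have hbound : ∀ i : ℕ, (∑ E ∈ univ.filter (fun E : History (Fin (i + 1 - 1) × Fin (i + 1 + 1)) (Fin (i + 1) × Fin (i + 1))
        (Tk i) => ∑ j : Fin (i + 1), proj (D i (stSyn (HZ (i + 1)) (Tk i) E) + E) (⟨0, by omega⟩, j) = 1),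
        phenomenologicalWeight (Tk i) p q (supp E)) ≤
      ((i + 1 : ℕ) : ℝ) * (A * ((i : ℝ) + 1) ^ m) * C * r ^ (i + 1) / (1 - r) := by
    intro i
    refine (rsc_stZ_sum_oddResidual_le_twoRate (L := i + 1) (by omega) hν hC (hD i) hp0 hq0 hpρ hqρ hρ hr1).trans ?_
    have hk : (0 : ℝ) ≤ ((i + 1 : ℕ) : ℝ) := by positivity
    have h1 : ((i + 1 : ℕ) : ℝ) * (Tk i : ℝ) * C ≤ ((i + 1 : ℕ) : ℝ) * (A * ((i : ℝ) + 1) ^ m) * C :=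
      mul_le_mul_of_nonneg_right (mul_le_mul_of_nonneg_left (hA i) hk) hC0
    exact div_le_div_of_nonneg_right (mul_le_mul_of_nonneg_right h1 (pow_nonneg hr0 _)) h1r.le
  have hnonneg : ∀ i : ℕ, 0 ≤ ∑ E ∈ univ.filter (fun E : History (Fin (i + 1 - 1) × Fin (i + 1 + 1))
        (Fin (i + 1) × Fin (i + 1)) (Tk i) =>
        ∑ j : Fin (i + 1), proj (D i (stSyn (HZ (i + 1)) (Tk i) E) + E) (⟨0, by omega⟩, j) = 1),
        phenomenologicalWeight (Tk i) p q (supp E) := by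
    intro i
    refine Finset.sum_nonneg fun E _ => indepWeight_nonneg (CheckDrawing.phenomRate_nonneg' hp0 hq0) ?_ _
    intro ℓ
    exact (CheckDrawing.phenomRate_le' hpρ hqρ ℓ).trans (by linarith)
  have hlim : Tendsto (fun i : ℕ => ((i + 1 : ℕ) : ℝ) * (A * ((i : ℝ) + 1) ^ m) * C * r ^ (i + 1) / (1 - r))
      atTop (𝓝 0) := by
    have h0 := tendsto_pow_const_mul_const_pow_of_abs_lt_one (m + 1) (show |r| < 1 by rwa [abs_of_nonneg hr0])
    have h1 : Tendsto (fun i : ℕ => ((i + 1 : ℕ) : ℝ) ^ (m + 1) * r ^ (i + 1)) atTop (𝓝 0) :=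
      (Filter.tendsto_add_atTop_iff_nat 1).2 h0
    have h2 := h1.const_mul (A * C / (1 - r))
    rw [mul_zero] at h2
    refine h2.congr fun i => ?_
    have h1r0 : 1 - r ≠ 0 := h1r.ne'
    push_cast
    field_simp
    ring
  exact squeeze_zero hnonneg hbound hlim

open Classical in
/-- **Equal rates**: the rotated space-time counting bound tends to zero for `q = p`, `0 ≤ p ≤ 1/2`, `4ν² p(1-p) < 1`, along
`L = i + 1` (polynomially many rounds, every family of minimum-weight space-time decoders of the `H_Z` sectors).
[cite: DennisEtAl2002, §5.3 eqs. (threshold_iso), (fail_iso)] -/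
theorem rsc_stZ_tendsto_sum_oddResidual {C ν : ℝ} (hν : 0 < ν) (hC : ToricCode.SAWCountBound3 C ν) {Tk : ℕ → ℕ}
    (hT : ToricCode.IsPolyBounded Tk)
    (D : ∀ i : ℕ, STDecoder (Fin (i + 1 - 1) × Fin (i + 1 + 1)) (Fin (i + 1) × Fin (i + 1)) (Tk i))
    (hD : ∀ i, (D i).IsMinWeight (stSyn (HZ (i + 1)) (Tk i)) (stCycles (HZ (i + 1)) (Tk i)) hammingNorm)
    {p : ℝ} (hp0 : 0 ≤ p) (hp : p ≤ 1 / 2) (h4 : 4 * ν ^ 2 * (p * (1 - p)) < 1) :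
    Tendsto (fun i => ∑ E ∈ univ.filter (fun E : History (Fin (i + 1 - 1) × Fin (i + 1 + 1)) (Fin (i + 1) × Fin (i + 1))
        (Tk i) => ∑ j : Fin (i + 1), proj (D i (stSyn (HZ (i + 1)) (Tk i) E) + E) (⟨0, by omega⟩, j) = 1),
        phenomenologicalWeight (Tk i) p p (supp E)) atTop (𝓝 0) :=
  rsc_stZ_tendsto_sum_oddResidual_twoRate hν hC hT D hD hp0 hp0 le_rfl le_rfl hp h4

end RotatedSurface

end Literature.InformationTheory.QuantumCodes
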